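/-
Copyright (c) 2026 the pub-hodgecm-mathlib formalisation cell (harness21).  Prover seat hodgecm-mathlib-K2E5-p10 (g4), Track B «K2-LIT» ∕ h413
(`stmt-HodgeConjecture-24833`), line `K2_E3_EllipticInputs`, unit U12, §L road «U-iso-T» brick (G⁺-b)/(K4-S): EXACT LOCALISATION OF THE QUADRATIC-CHARACTER
WEIGHT AT A SIMPLE ROOT and the TWO-SHELL CANCELLATION `∫_{𝔭^m ∖ 𝔭^{m+2}} χ̃(v)‖v‖⁻¹ dv = 0`.  2026-09-04.
-/
import Summits.HodgeConjecture.HodgeConjecture.Theorems.K2E3LocalFieldQuadraticCharSignWeight   -- ★ p857410 (K2E5-p17 (g3)): `norm_extend_le_one`, `extend_eq_neg_one_zpow_of_mem_shell`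
import Summits.HodgeConjecture.HodgeConjecture.Theorems.K2E3LocalFieldSignCharZetaBalls          -- ★ p857390 (K2E5-p17 (g3)): `setIntegral_sdiff_sign_mul_normInv`
import Literature.NumberTheory.Automorphic.TateGaussSums                                         -- ★ `TateDirect.extend_*`, `setIntegral_shell_mul_extend_eq_zero`
import HarnessLib

/-!
# K2_E3 road (h413), §L brick (G⁺-b)/(K4-S) — localisation of `χ̃(R)‖R‖⁻¹` at a simple root; two-shell cancellation

Cell `pub/hodgecm-mathlib` (D-0151), Track B, seat K2E5-p10 (g4) (E3 §L line; dealer K2E3-plan (g3); (G⁺-b): line side K2E5-p17 (g3), `K`-side this seat).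
`--supports stmt-HodgeConjecture-24833 --as helper`; THEOREMS ONLY (no definition ∕ instance ∕ notation ∕ named fact ∕ `sorry`); never imports `Cruxes/…/Lines`.
COUNT-NEUTRAL.

`χ : QuasiChar F` quadratic (`χ² = 1`), `χ̃ = Function.extend Units.val χ 0` (the line side's currency).  The 1-D analysis of the `K`-side studies
`∫ χ̃(R(σ)) ‖R(σ)‖⁻¹ 1[R(σ) ∉ 𝔭^{2n}] dσ` for the cell quadratics `R`; near a SIMPLE ROOT `σ₁` (`R(σ₁ + v) = a·v·(d + v)`, `d = σ₁ − σ₂ ≠ 0`) the weight is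
EXACTLY the model weight:
* §1 `exists_conductorBall` — there is `e ≥ 1` with `χ̃(1 + t) = 1` for `t ∈ 𝔭^e` (★ `QuasiChar.exists_hasConductorExp`);
* §2 `extend_rootFactor_eq` ∕ `normAbs_rootFactor_eq` — for `‖v‖ ≤ ‖d‖·(q⁻¹)^e`: `χ̃(a v (d+v)) = χ̃(a d)·χ̃(v)` and `‖a v (d+v)‖ = ‖a d‖·‖v‖`;
  `rootFactor_mem_primePowBall_iff` — `a v (d+v) ∈ 𝔭^j ↔ v ∈ 𝔭^{j−w}` (`‖ad‖ = (q⁻¹)^w`);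
* §3 `setIntegral_twoShells_extend_mul_normInv_eq_zero` — `∫_{𝔭^m ∖ 𝔭^{m+2}} χ̃(v) ‖v‖⁻¹ dv = 0` for every quadratic `χ ≠ 1`: unramified — the two shells
  contribute `±(1−q⁻¹)μ(𝒪)` (★ p857390 ∕ p857410); ramified — each shell vanishes (★ `setIntegral_shell_mul_extend_eq_zero`);
* §4 `setIntegral_ball_rootFactor_twoShells_eq_zero` — hence `∫_{v ∈ 𝔭^α} (χ̃‖·‖⁻¹1_{𝔭^{2n}∖𝔭^{2n+2}})(a v (d+v)) dv = 0` once `𝔭^α` is inside the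
  localisation ball and `2n − w ≥ α`: the increments `B_{n+1} − B_n` of the truncated cell integrals VANISH near simple roots (eventual constancy, (K4-a)).
[HarishChandra1999AdmissibleDistributions, §7] [LabesseLanglands1979, §2] [Tate1950, §2.5]
HONEST LABEL: HC_CM is proved only modulo the 7 printed citations (2 remaining named inputs: hLiu418 = stmt-HodgeConjecture-24832, h413 =
stmt-HodgeConjecture-24833) until rung 0 closes; count-neutral helper toward (LBU-2⁺)∕(G⁺-b), NOT ★.

## References
* [HarishChandra1999AdmissibleDistributions] Harish-Chandra (DeBacker–Sally), *Admissible Invariant Distributions on Reductive p-adic Groups* (1999), §7.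
* [LabesseLanglands1979] J.-P. Labesse, R. P. Langlands, *L-indistinguishability for SL(2)*, Canad. J. Math. 31 (1979), §2.
* [Tate1950] J. Tate, *Fourier analysis in number fields and Hecke's zeta-functions* (1950), §2.5.
-/

set_option autoImplicit false
set_option linter.dupNamespace false   -- `Summit.HodgeConjecture.HodgeConjecture.…` (D-0017 nested layout; lakefile exemption for Summits)

noncomputable section

open MeasureTheory Measure Filter Topology Set
open scoped NNReal ENNReal Pointwise
open ValuativeRel
open Literature.NumberTheory.Automorphic Literature.NumberTheory.Automorphic.LocalFieldHaar Literature.NumberTheory.Automorphic.TateDirect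
open Literature.NumberTheory.GaloisRepresentations Literature.NumberTheory.GaloisRepresentations.IsNonarchimedeanLocalField
open Summit.HodgeConjecture.HodgeConjecture.Cruxes.H413.K2E3LocalFieldSignCharZetaBalls
open Summit.HodgeConjecture.HodgeConjecture.Cruxes.H413.K2E3LocalFieldQuadraticCharSignWeight

namespace Summit.HodgeConjecture.HodgeConjecture.Cruxes.H413.K2E3LocalFieldQuadraticCharLocalisation

variable {F : Type*} [Field F] [ValuativeRel F] [TopologicalSpace F] [IsNonarchimedeanLocalField F]

/-! ## §1  A conductor ball -/

/-- **A conductor ball**: there is `e ≥ 1` such that `χ̃(1 + t) = 1` for all `t ∈ 𝔭^e`. [cite: Tate1950, §2.3] -/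
theorem exists_conductorBall (χ : QuasiChar F) :
    ∃ e : ℕ, 1 ≤ e ∧ ∀ t ∈ primePowBall F (e : ℤ), Function.extend ((↑) : Fˣ → F) (fun u => ((χ u : ℂˣ) : ℂ)) 0 (1 + t) = 1 := by
  obtain ⟨a, ha, -⟩ := QuasiChar.exists_hasConductorExp χ
  refine ⟨max a 1, le_max_right _ _, fun t ht => ?_⟩
  have h1 : (1 : ℕ) ≤ max a 1 := le_max_right _ _
  have h0 : 1 + t ≠ 0 := one_add_ne_zero h1 ht
  have hmem : Units.mk0 (1 + t) h0 ∈ unitFiltration F a := by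
    have h := one_add_mem_unitFiltration h1 ht h0
    refine ⟨h.1, h.2.trans ?_⟩
    rw [← zpow_natCast, ← zpow_natCast]
    exact zpow_le_zpow_right_of_le_one₀ inv_residueFieldCard_pos inv_residueFieldCard_lt_one.le (by exact_mod_cast le_max_left a 1)
  have := ha _ hmem
  rw [show (1 + t : F) = ((Units.mk0 (1 + t) h0 : Fˣ) : F) from rfl, extend_apply_coe, this, Units.val_one]

/-! ## §2  Exact localisation at a simple root -/

/-- **Exact localisation of the character**: if `χ̃(1 + t) = 1` on `𝔭^e` and `‖v‖ ≤ ‖d‖(q⁻¹)^e` (`d ≠ 0`), then `χ̃(a·v·(d + v)) = χ̃(a·d)·χ̃(v)`.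
[cite: HarishChandra1999AdmissibleDistributions, §7] -/
theorem extend_rootFactor_eq (χ : QuasiChar F) {e : ℕ}
    (he : ∀ t ∈ primePowBall F (e : ℤ), Function.extend ((↑) : Fˣ → F) (fun u => ((χ u : ℂˣ) : ℂ)) 0 (1 + t) = 1)
    (a : F) {d : F} (hd : d ≠ 0) {v : F} (hv : normAbs F v ≤ normAbs F d * ((residueFieldCard F : ℝ≥0)⁻¹) ^ (e : ℤ)) :
    Function.extend ((↑) : Fˣ → F) (fun u => ((χ u : ℂˣ) : ℂ)) 0 (a * v * (d + v)) =
      Function.extend ((↑) : Fˣ → F) (fun u => ((χ u : ℂˣ) : ℂ)) 0 (a * d) * Function.extend ((↑) : Fˣ → F) (fun u => ((χ u : ℂˣ) : ℂ)) 0 v := by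
  have hd0 : 0 < normAbs F d := pos_iff_ne_zero.2 ((map_ne_zero (normAbs F)).2 hd)
  have ht : v / d ∈ primePowBall F (e : ℤ) := by
    rw [mem_primePowBall_iff, map_div₀, div_le_iff₀ hd0, mul_comm]; exact hv
  have hfac : a * v * (d + v) = (a * d) * v * (1 + v / d) := by field_simp
  have h1t : Function.extend ((↑) : Fˣ → F) (fun u => ((χ u : ℂˣ) : ℂ)) 0 (1 + v / d) = 1 := he _ ht
  by_cases ha : a = 0
  · simp [ha]
  by_cases hv0 : v = 0
  · simp [hv0]
  have h10 : 1 + v / d ≠ 0 := fun h => by rw [h, extend_apply_zero] at h1t; exact zero_ne_one h1t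
  rw [hfac, extend_mul χ (mul_ne_zero (mul_ne_zero ha hd) hv0) h10, extend_mul χ (mul_ne_zero ha hd) hv0, h1t, mul_one]

/-- **Exact localisation of the norm**: `‖a·v·(d + v)‖ = ‖a d‖·‖v‖` for `‖v‖ ≤ ‖d‖(q⁻¹)^e`, `e ≥ 1`. [cite: HarishChandra1999AdmissibleDistributions, §7] -/
theorem normAbs_rootFactor_eq {e : ℕ} (he : 1 ≤ e) (a : F) {d : F} (hd : d ≠ 0) {v : F}
    (hv : normAbs F v ≤ normAbs F d * ((residueFieldCard F : ℝ≥0)⁻¹) ^ (e : ℤ)) :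
    normAbs F (a * v * (d + v)) = normAbs F (a * d) * normAbs F v := by
  have hd0 : 0 < normAbs F d := pos_iff_ne_zero.2 ((map_ne_zero (normAbs F)).2 hd)
  have hlt : normAbs F v < normAbs F d := by
    refine hv.trans_lt ?_
    conv_rhs => rw [← mul_one (normAbs F d)]
    exact mul_lt_mul_of_pos_left (by rw [zpow_natCast]; exact pow_lt_one₀ bot_le inv_residueFieldCard_lt_one (by omega)) hd0
  rw [map_mul, map_mul, map_mul, normAbs_add_eq_of_lt hlt]
  ring

/-- **Membership of the localised value in a ball**: with `‖a d‖ = (q⁻¹)^w` and `‖v‖ ≤ ‖d‖(q⁻¹)^e` (`e ≥ 1`):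
`a·v·(d+v) ∈ 𝔭^j ↔ v ∈ 𝔭^{j − w}`. [folklore] -/
theorem rootFactor_mem_primePowBall_iff {e : ℕ} (he : 1 ≤ e) {a d : F} (hd : d ≠ 0) {w : ℤ}
    (hw : normAbs F (a * d) = ((residueFieldCard F : ℝ≥0)⁻¹) ^ w) {v : F} (hv : normAbs F v ≤ normAbs F d * ((residueFieldCard F : ℝ≥0)⁻¹) ^ (e : ℤ)) (j : ℤ) :
    a * v * (d + v) ∈ primePowBall F j ↔ v ∈ primePowBall F (j - w) := by
  rw [mem_primePowBall_iff, normAbs_rootFactor_eq he a hd hv, ← map_mul, ← mem_primePowBall_iff]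
  exact mul_mem_primePowBall_iff hw

/-! ## §3  Two-shell cancellation -/

section Shells
variable [MeasurableSpace F] [BorelSpace F] (μ : Measure F) [μ.IsAddHaarMeasure]

/-- **TWO-SHELL CANCELLATION**: for a quadratic character `χ ≠ 1` (`χ² = 1`) and every `m ∈ ℤ`, `∫_{𝔭^m ∖ 𝔭^{m+2}} χ̃(v)·‖v‖⁻¹ dμ(v) = 0`.
Unramified: the shells `m`, `m+1` contribute `(−1)^m(1−q⁻¹)μ(𝒪)` and `(−1)^{m+1}(1−q⁻¹)μ(𝒪)` (★ p857390); ramified: each shell integral vanishes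
(★ `setIntegral_shell_mul_extend_eq_zero`). [cite: Tate1950, §2.5] [cite: LabesseLanglands1979, §2] -/
theorem setIntegral_twoShells_extend_mul_normInv_eq_zero (χ : QuasiChar F) (hχ2 : ∀ u, χ u * χ u = 1) (hχ1 : ∃ u, χ u ≠ 1) (m : ℤ) :
    ∫ v in primePowBall F m \ primePowBall F (m + 2),
      Function.extend ((↑) : Fˣ → F) (fun u => ((χ u : ℂˣ) : ℂ)) 0 v * ((((normAbs F v)⁻¹ : ℝ≥0) : ℝ) : ℂ) ∂μ = 0 := by
  by_cases hun : χ.IsUnramified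
  · obtain ⟨ϖ, _, hϖ⟩ := exists_normAbs_eq_inv (F := F)
    have h := setIntegral_sdiff_sign_mul_normInv μ (measurable_extend χ) (norm_extend_le_one χ hχ2)
      (fun j x hx => extend_eq_neg_one_zpow_of_mem_shell χ hun hχ2 hχ1 hϖ j x hx) m 2
    rw [show (m + ((2 : ℕ) : ℤ)) = m + 2 by norm_num] at h
    have h2 : ((-1 : ℂ)) ^ (m + 2) = (-1) ^ m := by
      rw [zpow_add₀ (by norm_num : (-1 : ℂ) ≠ 0), show ((-1 : ℂ)) ^ (2 : ℤ) = 1 by norm_num, mul_one]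
    rw [h, h2, sub_self, zero_div, mul_zero]
  · -- ramified: split into the two shells
    have hsplit : primePowBall F m \ primePowBall F (m + 2) =
        (primePowBall F m \ primePowBall F (m + 1)) ∪ (primePowBall F (m + 1) \ primePowBall F (m + 1 + 1)) := by
      ext t
      by_cases ht1 : t ∈ primePowBall F (m + 1)
      · have htm : t ∈ primePowBall F m := primePowBall_antitone (by omega) ht1
        simp [Set.mem_sdiff, ht1, htm, show m + 1 + 1 = m + 2 by ring]
      · have ht2 : t ∉ primePowBall F (m + 2) := fun h => ht1 (primePowBall_antitone (by omega) h)
        simp [Set.mem_sdiff, ht1, ht2, show m + 1 + 1 = m + 2 by ring]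
    have hdisj : Disjoint (primePowBall F m \ primePowBall F (m + 1)) (primePowBall F (m + 1) \ primePowBall F (m + 1 + 1)) :=
      Set.disjoint_left.2 fun _ ht ht' => ht.2 ht'.1
    have hint : ∀ a b : ℤ, IntegrableOn (fun v => Function.extend ((↑) : Fˣ → F) (fun u => ((χ u : ℂˣ) : ℂ)) 0 v *
        ((((normAbs F v)⁻¹ : ℝ≥0) : ℝ) : ℂ)) (primePowBall F a \ primePowBall F b) μ :=
      fun a b => integrableOn_sign_mul_normInv μ (measurable_extend χ) (norm_extend_le_one χ hχ2) a b
    rw [hsplit, setIntegral_union hdisj (measurableSet_shell _) (hint _ _) (hint _ _)]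
    have hshell : ∀ j : ℤ, ∫ v in primePowBall F j \ primePowBall F (j + 1),
        Function.extend ((↑) : Fˣ → F) (fun u => ((χ u : ℂˣ) : ℂ)) 0 v * ((((normAbs F v)⁻¹ : ℝ≥0) : ℝ) : ℂ) ∂μ = 0 := by
      intro j
      have h := setIntegral_shell_mul_extend_eq_zero μ hun j (fun v => ((((normAbs F v)⁻¹ : ℝ≥0) : ℝ) : ℂ))
        (fun u hu x => by simp only [map_mul, hu, one_mul])
      simpa only [mul_comm] using h
    rw [hshell, hshell, add_zero]

/-! ## §4  The increment of the truncated weight vanishes near a simple root -/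

/-- **Near a simple root the `n`-increments vanish.**  Let `χ` be quadratic `≠ 1`, `χ̃(1+t) = 1` on `𝔭^e` (`e ≥ 1`), `d ≠ 0`, `‖a d‖ = (q⁻¹)^w`, and let
`𝔭^α` lie inside the localisation ball (`(q⁻¹)^α ≤ ‖d‖(q⁻¹)^e`).  Then for every `n` with `α ≤ 2n − w`:
`∫_{v ∈ 𝔭^α} 1[a v (d+v) ∈ 𝔭^{2n} ∖ 𝔭^{2n+2}] · χ̃(a v (d+v)) · ‖a v (d+v)‖⁻¹ dμ(v) = 0`.
[cite: HarishChandra1999AdmissibleDistributions, §7] [cite: LabesseLanglands1979, §2] -/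
theorem setIntegral_ball_rootFactor_twoShells_eq_zero (χ : QuasiChar F) (hχ2 : ∀ u, χ u * χ u = 1) (hχ1 : ∃ u, χ u ≠ 1) {e : ℕ} (he : 1 ≤ e)
    (hce : ∀ t ∈ primePowBall F (e : ℤ), Function.extend ((↑) : Fˣ → F) (fun u => ((χ u : ℂˣ) : ℂ)) 0 (1 + t) = 1)
    {a d : F} (hd : d ≠ 0) {w : ℤ} (hw : normAbs F (a * d) = ((residueFieldCard F : ℝ≥0)⁻¹) ^ w)
    {α : ℤ} (hα : ((residueFieldCard F : ℝ≥0)⁻¹) ^ α ≤ normAbs F d * ((residueFieldCard F : ℝ≥0)⁻¹) ^ (e : ℤ)) {n : ℕ} (hn : α ≤ 2 * (n : ℤ) - w) :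
    ∫ v in primePowBall F α, (primePowBall F (2 * (n : ℤ)) \ primePowBall F (2 * (n : ℤ) + 2)).indicator
        (fun y => Function.extend ((↑) : Fˣ → F) (fun u => ((χ u : ℂˣ) : ℂ)) 0 y * ((((normAbs F y)⁻¹ : ℝ≥0) : ℝ) : ℂ)) (a * v * (d + v)) ∂μ = 0 := by
  -- on the ball, the integrand is the model weight on the annulus `𝔭^{2n−w} ∖ 𝔭^{2n+2−w}` times the constant `χ̃(ad)‖ad‖⁻¹`
  have hball : ∀ v ∈ primePowBall F α, normAbs F v ≤ normAbs F d * ((residueFieldCard F : ℝ≥0)⁻¹) ^ (e : ℤ) :=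
    fun v hv => (mem_primePowBall_iff.1 hv).trans hα
  have hsub : primePowBall F (2 * (n : ℤ) - w) \ primePowBall F (2 * (n : ℤ) - w + 2) ⊆ primePowBall F α :=
    fun v hv => primePowBall_antitone hn hv.1
  have hpt : ∀ v ∈ primePowBall F α, (primePowBall F (2 * (n : ℤ)) \ primePowBall F (2 * (n : ℤ) + 2)).indicator
      (fun y => Function.extend ((↑) : Fˣ → F) (fun u => ((χ u : ℂˣ) : ℂ)) 0 y * ((((normAbs F y)⁻¹ : ℝ≥0) : ℝ) : ℂ)) (a * v * (d + v)) =
      (Function.extend ((↑) : Fˣ → F) (fun u => ((χ u : ℂˣ) : ℂ)) 0 (a * d) * ((((normAbs F (a * d))⁻¹ : ℝ≥0) : ℝ) : ℂ)) *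
        (primePowBall F (2 * (n : ℤ) - w) \ primePowBall F (2 * (n : ℤ) - w + 2)).indicator
          (fun v => Function.extend ((↑) : Fˣ → F) (fun u => ((χ u : ℂˣ) : ℂ)) 0 v * ((((normAbs F v)⁻¹ : ℝ≥0) : ℝ) : ℂ)) v := by
    intro v hv
    have hv' := hball v hv
    have hmem : a * v * (d + v) ∈ primePowBall F (2 * (n : ℤ)) \ primePowBall F (2 * (n : ℤ) + 2) ↔
        v ∈ primePowBall F (2 * (n : ℤ) - w) \ primePowBall F (2 * (n : ℤ) - w + 2) := by
      rw [Set.mem_sdiff, Set.mem_sdiff, rootFactor_mem_primePowBall_iff he hd hw hv', rootFactor_mem_primePowBall_iff he hd hw hv',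
        show 2 * (n : ℤ) + 2 - w = 2 * (n : ℤ) - w + 2 by ring]
    by_cases h : v ∈ primePowBall F (2 * (n : ℤ) - w) \ primePowBall F (2 * (n : ℤ) - w + 2)
    · rw [indicator_of_mem (hmem.2 h), indicator_of_mem h, extend_rootFactor_eq χ hce a hd hv', normAbs_rootFactor_eq he a hd hv',
        mul_inv, NNReal.coe_mul, Complex.ofReal_mul]
      ring
    · rw [indicator_of_notMem (fun h' => h (hmem.1 h')), indicator_of_notMem h, mul_zero]
  rw [setIntegral_congr_fun (measurableSet_primePowBall α) hpt, integral_const_mul, integral_indicator (measurableSet_shell' _),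
    Measure.restrict_restrict (measurableSet_shell' _), inter_eq_left.2 hsub, setIntegral_twoShells_extend_mul_normInv_eq_zero μ χ hχ2 hχ1, mul_zero]
where
  /-- measurability of a two-shell annulus -/
  measurableSet_shell' (m : ℤ) : MeasurableSet (primePowBall F m \ primePowBall F (m + 2)) :=
    (measurableSet_primePowBall m).diff (measurableSet_primePowBall (m + 2))

end Shells

end Summit.HodgeConjecture.HodgeConjecture.Cruxes.H413.K2E3LocalFieldQuadraticCharLocalisation

end
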